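import Literature.NumberTheory.QuadraticFields.RingClassForms
import Literature.NumberTheory.QuadraticFields.IdealsOfPrimePowerNorm
import Literature.NumberTheory.QuadraticFields.BinaryQuadraticFormsPrimeRepresentation
import Literature.NumberTheory.NumberFields.RingClassFieldOfConductor
import HarnessLib

/-!
# A prime ideal of degree one prime to the conductor is the ideal of a form `(p, β, c)`, and the
# form of its ring class represents `p` (Cox, *Primes of the form x² + ny²*, Thm. 7.7 with Prop. 7.20 / 7.22)

Topic `NumberTheory/QuadraticFields`, namespace `Literature.NumberTheory.QuadraticFields.RingClass`
(continuing `RingClassOrder.lean`, `RingClassForms.lean`: the order `𝒪 = ℤ + f𝓞_K` of conductor `f` of an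
imaginary quadratic field `K` as the abstract order `O_D`, `D = f² d_K`, with its embedding
`ι : O_D → 𝓞 K`, the form ideals `𝔄_q = 𝔞_q 𝓞_K` and the dictionary «classes of primitive positive definite
forms of discriminant `D`» `↔` «`I_K(f)/P_{K,ℤ}(f)`»).  THEOREMS ONLY: no definition, no named fact.

Cox, §7.B Thm. 7.7 and its proof (p. 137–140), §7.C Prop. 7.20 and Prop. 7.22 (pp. 143–145), and the
remark closing §7.C: the isomorphism `C(D) ≃ C(𝒪) ≃ I_K(f)/P_{K,ℤ}(f)` sends the class of a prime `𝒪_K`-ideal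
`𝔭 ∤ f` of norm `p` to the class of a form `(p, β, ·)`, so that «`p` is represented by the forms of that
class» (the step «`p = N(𝔭)` is represented by the form corresponding to `𝔭`» by which Thm. 9.12 / (9.4) of
Cox and [ThornerZaman2017, proof of Thm. 1.2] pass from prime ideals in a ring class to primes represented
by a form).  We prove, for an imaginary quadratic `K` with integral basis `(1, ω)`, `ω² = m + tω`, the order
data `D = f²(t² + 4m)`, `2s = D − ft`, `ι(ω_D) = fω + s` of `RingClassOrder.lean`, and a prime `v ∤ f` of
`𝓞 K` of prime norm `p`:

* (private) `span_pair_natCast_mul_eq_of_coprime` — `(p, f·x) = (p, x)` for `gcd(p, f) = 1` (bookkeeping);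
* `exists_form_map_fIdeal_eq_of_absNorm_prime` — **`𝔭_v = 𝔄_q` for a primitive positive definite form
  `q = (p, 2k − D, C)` of discriminant `D` with `gcd(p, f) = 1`**: `𝔭_v = (p, ω − k₀)` (tree
  `exists_eq_span_pair_of_absNorm_eq_prime`), `k = fk₀ + s`, `ι(ω_D − k) = f(ω − k₀)`, primitivity by Cox's
  Lemma 7.5 / 7.18 (`isPrimitive_of_isCoprime`);
* `primeClass_eq_mk_of_map_fIdeal_eq` — hence `[𝔭_v] = [𝔄_q]` in `I_K(f)/P_{K,ℤ}(f)`;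
* `exists_eval_eq_absNorm_of_mk_eq_primeClass` — **if the class of `𝔄_Q` is `[𝔭_v]` then `Q` represents
  `p = N𝔭_v`** (`Q ∼ q` properly by `properEquiv_of_mk_eq`, and `q(1, 0) = p`).

## References

* D. A. Cox, *Primes of the form x² + ny²*, 2nd ed., Wiley (2013), §7.B Thm. 7.7, §7.C Lemma 7.18,
  Props. 7.20, 7.22; §9.B Thm. 9.12. [Cox2013]
* J. Thorner, A. Zaman, *An explicit bound for the least prime ideal in the Chebotarev density theorem*,
  Algebra Number Theory 11 (2017) 1135–1197, proof of Thm. 1.2 (§12). [ThornerZaman2017]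

## Mathlib / tree search

Tree: `exists_eq_span_pair_of_absNorm_eq_prime` (`IdealsOfPrimePowerNorm`), `isPrimitive_of_isCoprime`,
`disc_mk_eq`, `sq_add_eq`, `emb_apply` (`RingClassOrder`), `mk0_map_fIdeal_mem`, `properEquiv_of_mk_eq`
(`RingClassForms`), `RingClassField.primeClass`, `primeClass_of_sup_eq_top`, `idealClass_eq`,
`sup_span_eq_top_iff_not_le` (`RingClassFieldOfConductor`), `ProperEquiv.exists_eval_eq`
(`BinaryQuadraticFormsPrimeRepresentation`).  `lean search 'primeClass.*fIdeal|fIdeal.*absNorm'`: nothing prior.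
-/

noncomputable section

open scoped QuadraticAlgebra nonZeroDivisors NumberField
open Module NumberField QuadraticAlgebra Ideal IsDedekindDomain
open Literature.Computability.Cryptography.Hallgren2005
open Literature.Computability.Cryptography.Hallgren2005.OrderCl
open Literature.Computability.Cryptography.Hallgren2005.FormComposition (mOf kOf four_mul_mOf)
open Literature.NumberTheory.QuadraticFields.Quadratic
open Literature.NumberTheory.QuadraticFields.Quadratic.BinQF
open Literature.NumberTheory.NumberFields Literature.NumberTheory.NumberFields.RingClassField

namespace Literature.NumberTheory.QuadraticFields.RingClass

/-! ### Bookkeeping: `(p, f x) = (p, x)` for `gcd(p, f) = 1` -/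

/-- `(p, f·x) = (p, x)` as ideals when `gcd(p, f) = 1` (`x = (uf + wp)x`). [folklore] -/
private theorem span_pair_natCast_mul_eq_of_coprime {R : Type*} [CommRing R] {p f : ℕ} (h : Nat.Coprime p f)
    (x : R) : Ideal.span {(p : R), (f : R) * x} = Ideal.span {(p : R), x} := by
  apply le_antisymm
  · rw [Ideal.span_le]
    rintro y hy
    simp only [Set.mem_insert_iff, Set.mem_singleton_iff] at hy
    rcases hy with rfl | rfl
    · exact Ideal.subset_span (by simp)
    · exact Ideal.mul_mem_left _ _ (Ideal.subset_span (by simp))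
  · rw [Ideal.span_le]
    rintro y hy
    simp only [Set.mem_insert_iff, Set.mem_singleton_iff] at hy
    rcases hy with rfl | rfl
    · exact Ideal.subset_span (by simp)
    · obtain ⟨u, w, huw⟩ := Nat.isCoprime_iff_coprime.mpr h.symm
      rw [SetLike.mem_coe, Ideal.mem_span_pair]
      refine ⟨(w : R) * y, (u : R), ?_⟩
      have hcast : ((u * (f : ℤ) + w * (p : ℤ) : ℤ) : R) = 1 := by rw [huw]; simp
      push_cast at hcast
      linear_combination y * hcast

variable {K : Type} [Field K] [NumberField K]
variable (b : Basis (Fin 2) ℤ (𝓞 K)) (hb : b 0 = 1) {t m : ℤ}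
  (hω : b 1 * b 1 = (m : 𝓞 K) + (t : 𝓞 K) * b 1)
variable {f : ℕ} {Δ : NegDiscr} {s : ℤ}
  (hD : Δ.D = (f : ℤ) ^ 2 * (t ^ 2 + 4 * m)) (hs : 2 * s = Δ.D - f * t)
variable (ι : QO Δ →+* 𝓞 K) (hι : ι ω = (f : 𝓞 K) * b 1 + (s : 𝓞 K))

/-! ### A prime of degree one prime to `f` is a form ideal `𝔄_q`, `q = (p, β, c)` -/

/-- `p ∤ f` for a prime `v ∤ f` of norm `p` (`p ∈ 𝔭_v`). [folklore] -/
private theorem coprime_absNorm_of_not_le (v : HeightOneSpectrum (𝓞 K))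
    (hv : ¬ Ideal.span {(f : 𝓞 K)} ≤ v.asIdeal) (hp : (absNorm v.asIdeal).Prime) :
    Nat.Coprime (absNorm v.asIdeal) f := by
  rw [Nat.Prime.coprime_iff_not_dvd hp]
  rintro ⟨c, hc⟩
  apply hv
  rw [Ideal.span_singleton_le_iff_mem, hc, Nat.cast_mul]
  exact Ideal.mul_mem_right _ _ (Ideal.absNorm_mem v.asIdeal)

include hb hω hD hs hι in
/-- **A degree-one prime `𝔭 ∤ f` is the ideal of a form `(p, β, c)`** (Cox, Thm. 7.7 with Prop. 7.20):
for a prime `v` of `𝓞 K` with `v ∤ f𝓞_K` and `N v = p` prime there is a primitive positive definite form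
`q = (p, 2k − D, C)` of discriminant `D = f² d_K`, `gcd(p, f) = 1`, with `𝔄_q = 𝔞_q 𝓞_K = 𝔭_v`.  Proof:
`𝔭_v = (p, ω − k₀)` with `p ∣ k₀² − tk₀ − m`; put `k = fk₀ + s`, so `ι(ω_D − k) = f(ω − k₀)` and
`(p, f(ω − k₀)) = (p, ω − k₀)`; `pC = k² − Dk − m(D)` with `C = f²C₀`; primitivity is Cox's Lemma 7.5/7.18.
[cite: Cox2013, §7.B Thm. 7.7 and §7.C Prop. 7.20] -/
theorem exists_form_map_fIdeal_eq_of_absNorm_prime (v : HeightOneSpectrum (𝓞 K))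
    (hv : ¬ Ideal.span {(f : 𝓞 K)} ≤ v.asIdeal) (hp : (absNorm v.asIdeal).Prime) :
    ∃ q : BinQF, q.IsPosPrim Δ.D ∧ q.a = absNorm v.asIdeal ∧ IsCoprime q.a (f : ℤ) ∧
      (fIdeal Δ q).map ι = v.asIdeal := by
  set p : ℕ := absNorm v.asIdeal with hpdef
  obtain ⟨k₀, C₀, hn₀, hveq⟩ := exists_eq_span_pair_of_absNorm_eq_prime b hb hω hp hpdef.symm
  have hpf : Nat.Coprime p f := coprime_absNorm_of_not_le v hv hp
  have hcopZ : IsCoprime (p : ℤ) (f : ℤ) := Nat.isCoprime_iff_coprime.mpr hpf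
  have hsq := sq_add_eq hD hs
  set k : ℤ := f * k₀ + s with hk
  set C : ℤ := (f : ℤ) ^ 2 * C₀ with hC
  have hAC : (p : ℤ) * C = k ^ 2 - Δ.D * k - mOf Δ.D := by
    rw [hk, hC]
    linear_combination (f : ℤ) ^ 2 * hn₀ - (f : ℤ) * k₀ * hs - hsq
  obtain ⟨hdisc, hkq⟩ := disc_mk_eq (A := (p : ℤ)) (C := C) hD hAC
  have hprim := isPrimitive_of_isCoprime b hb hD ι hι hAC hcopZ
  set q : BinQF := ⟨p, 2 * k - Δ.D, C⟩ with hqdef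
  have hq : q.IsPosPrim Δ.D := ⟨hdisc, by simp only [q]; exact_mod_cast hp.pos, hprim⟩
  refine ⟨q, hq, rfl, hcopZ, ?_⟩
  rw [fIdeal, hkq, Ideal.map_span, Set.image_pair, map_sub, map_intCast, map_intCast, hι]
  have hgen : (f : 𝓞 K) * b 1 + (s : 𝓞 K) - ((k : ℤ) : 𝓞 K) = (f : 𝓞 K) * (b 1 - ((k₀ : ℤ) : 𝓞 K)) := by
    rw [hk]; push_cast; ring
  have hqa : ((q.a : ℤ) : 𝓞 K) = ((p : ℕ) : 𝓞 K) := by simp [q]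
  rw [hgen, hqa, span_pair_natCast_mul_eq_of_coprime hpf, hveq, Int.cast_natCast]

include hb hω hD hs hι in
/-- **`[𝔭_v] = [𝔄_q]` in `I_K(f)/P_{K,ℤ}(f)`** for the form `q` of `exists_form_map_fIdeal_eq_of_absNorm_prime`
(the ring class of a degree-one prime `v ∤ f` is the class of a form with first coefficient `N v`).
[cite: Cox2013, §7.C Prop. 7.22] -/
theorem exists_form_primeClass_eq_mk (v : HeightOneSpectrum (𝓞 K))
    (hv : ¬ Ideal.span {(f : 𝓞 K)} ≤ v.asIdeal) (hp : (absNorm v.asIdeal).Prime) :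
    ∃ q : BinQF, ∃ hq : q.IsPosPrim Δ.D, ∃ hqa : IsCoprime q.a (f : ℤ), q.a = absNorm v.asIdeal ∧
      primeClass f v = QuotientGroup.mk ⟨_, mk0_map_fIdeal_mem ι hq hqa⟩ := by
  obtain ⟨q, hq, hqa', hqa, hmap⟩ := exists_form_map_fIdeal_eq_of_absNorm_prime b hb hω hD hs ι hι v hv hp
  refine ⟨q, hq, hqa, hqa', ?_⟩
  rw [primeClass_of_sup_eq_top f ((sup_span_eq_top_iff_not_le f).mpr hv), idealClass_eq]
  congr 2
  exact congrArg _ (Subtype.ext hmap.symm)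

include hb hω hD hs hι in
/-- **The form of the ring class of `𝔭` represents `p = N𝔭`** (Cox, Thm. 7.7 (iii) / §9.B: «`p` is
represented by the form corresponding to `[𝔭]`»): if `Q` is a primitive positive definite form of
discriminant `D = f²d_K` with `gcd(a_Q, f) = 1` whose class `[𝔄_Q] ∈ I_K(f)/P_{K,ℤ}(f)` is the class of a
prime `v ∤ f` of prime norm `p`, then `Q(x, y) = p` is solvable (`Q` is properly equivalent to the form
`q = (p, β, c)` with `𝔄_q = 𝔭_v`, and `q(1, 0) = p`). [cite: Cox2013, §7.B Thm. 7.7 and §9.B Thm. 9.12] -/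
theorem exists_eval_eq_absNorm_of_mk_eq_primeClass (hf : f ≠ 0) {Q : BinQF} (hQ : Q.IsPosPrim Δ.D)
    (hQa : IsCoprime Q.a (f : ℤ)) (v : HeightOneSpectrum (𝓞 K))
    (hv : ¬ Ideal.span {(f : 𝓞 K)} ≤ v.asIdeal) (hp : (absNorm v.asIdeal).Prime)
    (h : (QuotientGroup.mk ⟨_, mk0_map_fIdeal_mem ι hQ hQa⟩ : RingClassGroup K f) = primeClass f v) :
    ∃ x y : ℤ, Q.eval x y = absNorm v.asIdeal := by
  obtain ⟨q, hq, hqa, hqa', hcls⟩ := exists_form_primeClass_eq_mk b hb hω hD hs ι hι v hv hp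
  have he : Q.ProperEquiv q := properEquiv_of_mk_eq b hb ι hι hf hQ hq hQa hqa (h.trans hcls)
  refine he.symm.exists_eval_eq ⟨1, 0, ?_⟩
  rw [← hqa']
  simp [BinQF.eval]

end Literature.NumberTheory.QuadraticFields.RingClass

end
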